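import Summits.ABC.IUTFork.Cor312RegimeVerbatimPrVol
import HarnessLib

/-!
# [IUTchIII] Cor. 3.12 — the REGIME DICHOTOMY at the print-normalised sharp setting of record, negative half with the
# EXACT Θ-side at the odd unramified bad primes: `Θside + C₂ < Qside ⟹ ¬ Statement`, and the two halves together

PROOF-ONLY support piece of the abc-iut cell (Cor. 3.12 cone, D-0067; seat abc-iut-w4-d107, gen 4; part 8, sequel of
part 7 `Cor312RegimeVerbatimPrVol`). TAKES NO SIDE on [IUTchIII] Cor. 3.12; theorems only, 0 `def`s, no new `Prop` fact.
Setting: abc-iut-c312-7's `Real.settingPrVolSharp` (Θ-boxes and `q`-centre READ OFF the pilot ideles; no re-gluing);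
pilot ideles whose bad places all lie over a finite set `U` of ODD primes UNRAMIFIED in `F`, Θ-exponents `m_{i,p}`,
`q`-exponents `m_{q,p}` over `U`; `Θside := PN_i Σ_{p∈U} Σ_{v⃗} Pr(v⃗)·(−min_a m_{i,p}(v⃗ a)·log p)` (abc-iut-c312-5's
exact local hull value p433308, slot-symmetrised), `Qside := PN_i Σ_{p∈U} Σ_{v⃗} Pr(v⃗)·(−m_{q,p}(v⃗(last))·log p)`.

* `negLogTheta_settingPrVolSharp_le_exact_of_radii` — `−|log(Θ)| ≤ Θside + PN_i Σ_{p∈Bad} max(log(p²R_{p,i}/r_{p,i}), 0)`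
  for ANY finite `Bad ⊇ {2} ∪ {p | disc F}` with sandwich radii (part 1): EXACT at `U`, the crude polydisc bound of
  part 1 at the exceptional primes (unit Θ-boxes there, but the unit hull-set need not be (Ind2)-stable at a ramified
  prime), `≤ 0` at every other prime;
* **`settingPrVolSharp_regime_dichotomy`** — `∃ C₂ ≥ 0` chosen from `(X, logv)` BEFORE every context and idele binder:
  `(Qside ≤ Θside ⟹ Statement) ∧ (Θside + C₂ < Qside ⟹ ¬ Statement)`. At genuine sharp data over odd unramified bad
  primes the typed [IUTchIII] Cor. 3.12 is DECIDED, up to the constant `C₂` of the primes `2` and `p | disc(F)`, by the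
  sign of `Qside − Θside` — for single-bad-place sharp data `Σ_p log p·D_p·β_p·(PN_i((i+1)²β_p^{i+1}) − 1)`: TRUE in the
  split regime (inflation-dominated), FALSE at bad mass one with deep `q` — in BOTH directions by the
  (Ind1)-symmetrisation-versus-`q`-depth bookkeeping, independently of the disputed (xi-e)/(xi-f) inference.
HONEST SCOPE as in part 7: (Ind2) as typed at the real setting (`Real.ismDH`); sharp (Ind3) reading; trivial archimedean
container; free ideles; the positive instances are inflation-dominated and say nothing about print's intended content;
nothing here asserts or denies [IUTchIII] Cor. 3.12 for initial Θ-data. typed ≠ proved; instantiated ≠ endorsed.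
[claim: Mochizuki2012, status: disputed] [cite: DupuyHilado2025, §3.6, §3.9, §4.7, §4.9, §4.10]
[cite: ScholzeStix2018, §2.2 pp. 9–10]
-/

noncomputable section

open Set Function NumberField IsDedekindDomain
open scoped Pointwise

namespace Summit.ABC

namespace IUTFork

namespace Thm311

namespace Real

open Cor312 Cor312.Setting Cor312Vol Literature.IUT.LogThetaLattice Literature.IUT.LogVolume

variable {F : Type} [Field F] [NumberField F] (X : PilotData F) {logv : PadicLogs F} (hlog : LogvAnalytic logv)

section Radii

variable (M : Type) [Field M] [NumberField M]
  (archPk : ∀ (j : (thetaIndex X).Label) (vQ : (thetaIndex X).VQ), Set ((logShellsDH X logv).Packet j vQ))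
  (archSub : ∀ (j : (thetaIndex X).Label) (v : (thetaIndex X).V),
    Set ((logShellsDH X logv).Packet j ((thetaIndex X).over v)))
  (Ψ : ℤ → ∀ v : (thetaIndex X).V, v ∈ (thetaIndex X).Vbad → Set ((logShellsDH X logv).StarPacket v))
  (act : ℤ → ∀ v : (thetaIndex X).V, v ∈ (thetaIndex X).Vbad →
    (logShellsDH X logv).StarPacket v → Module.End ℚ ((logShellsDH X logv).StarPacket v))
  (Mmod : ℤ → ∀ j : (thetaIndex X).LabelStar, Set ((logShellsDH X logv).GlobalPacket j.1))
  (region : ℤ → ∀ j : (thetaIndex X).LabelStar, FinDivisor M → ∀ vQ : (thetaIndex X).VQ,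
    Set ((logShellsDH X logv).Packet j.1 vQ))
  (n : ℤ) {HT : Type} {LogLink : HT → HT → Type} {IsFull : ∀ {s t : HT}, LogLink s t → Prop}
  (lat : LGPGaussianLogThetaLattice LogLink IsFull)
  {Frd : Type} {IsoF : Frd → Frd → Type} {Ob : Frd → Type} {realify : Frd → Frd} {Strip : Type}
  {IsoS : Strip → Strip → Type} {Mv : ∀ v : (thetaIndex X).V, v ∈ (thetaIndex X).Vbad → Type}
  [∀ v h, Monoid (Mv v h)]
  (sig : GlobalLGPFrobenioidSignature (thetaIndex X).lstar (thetaIndex X).V (· ∈ (thetaIndex X).Vbad)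
    Frd IsoF Ob realify Strip IsoS Mv)
  (split : SplittingMonoids Mv) {ObΔ : Type} {N : ∀ v : (thetaIndex X).V, v ∈ (thetaIndex X).Vbad → Type}
  [∀ v h, Monoid (N v h)] (qData : QPilotData ObΔ N)
  (t : ∀ (pp : Nat.Primes) (_ : Fin X.lstar) (x : (thetaIndex X).Fibre (.inr pp)),
    haveI : Fact (pp : ℕ).Prime := ⟨pp.2⟩; kOf X pp.1 x)
  (tq : ∀ (pp : Nat.Primes) (x : (thetaIndex X).Fibre (.inr pp)), haveI : Fact (pp : ℕ).Prime := ⟨pp.2⟩; kOf X pp.1 x)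

/-- **The Θ-side from above with the EXACT value at the odd unramified bad primes**, radii form (module docstring).
[cite: DupuyHilado2025, §3.6, §4.7, §4.9, §4.10] -/
theorem negLogTheta_settingPrVolSharp_le_exact_of_radii (ht0 : ∀ pp i x, t pp i x ≠ 0)
    (ht1 : ∀ (pp : Nat.Primes) (i : Fin X.lstar) (x : (thetaIndex X).Fibre (.inr pp)),
      haveI : Fact (pp : ℕ).Prime := ⟨pp.2⟩; placeOf X pp.1 x ∉ X.S → ‖t pp i x‖ = 1)
    (htq0 : ∀ pp x, tq pp x ≠ 0)
    (htq1 : ∀ (pp : Nat.Primes) (x : (thetaIndex X).Fibre (.inr pp)),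
      haveI : Fact (pp : ℕ).Prime := ⟨pp.2⟩; placeOf X pp.1 x ∉ X.S → ‖tq pp x‖ = 1)
    (U : Finset Nat.Primes)
    (hU : ∀ (pp : Nat.Primes) (x : (thetaIndex X).Fibre (.inr pp)),
      haveI : Fact (pp : ℕ).Prime := ⟨pp.2⟩; placeOf X pp.1 x ∈ X.S → pp ∈ U)
    (hU2 : ∀ pp ∈ U, 2 < (pp : ℕ)) (hUd : ∀ pp ∈ U, ¬ ((pp : ℕ) : ℤ) ∣ NumberField.discr F)
    (m : ∀ pp : Nat.Primes, Fin (thetaIndex X).lstar → (thetaIndex X).Fibre (.inr pp) → ℤ)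
    (hm : ∀ (pp : Nat.Primes), pp ∈ U → ∀ (i : Fin (thetaIndex X).lstar) (x : (thetaIndex X).Fibre (.inr pp)),
      haveI : Fact (pp : ℕ).Prime := ⟨pp.2⟩; ‖t pp i x‖ = ‖((pp : ℕ) : ℚ_[pp]) ^ m pp i x‖)
    (Bad : Finset Nat.Primes) (hBad2 : ∀ pp : Nat.Primes, (pp : ℕ) ≤ 2 → pp ∈ Bad)
    (hBadD : ∀ pp : Nat.Primes, ((pp : ℕ) : ℤ) ∣ NumberField.discr F → pp ∈ Bad)
    (r R : Nat.Primes → Fin (thetaIndex X).lstar → ℝ) (hr0 : ∀ pp i, 0 < r pp i) (hR0 : ∀ pp i, 0 < R pp i)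
    (hball : ∀ (pp : Nat.Primes) (i : Fin (thetaIndex X).lstar), haveI : Fact (pp : ℕ).Prime := ⟨pp.2⟩
      ∀ z : (∀ s : (presAt X hlog pp).factorIdx (labelSucc i), (presAt X hlog pp).factorField (labelSucc i) s),
        (∀ s, ‖z s‖ < r pp i) → z ∈ (presAt X hlog pp).latticeF (labelSucc i) 1)
    (hbdd : ∀ (pp : Nat.Primes) (i : Fin (thetaIndex X).lstar), haveI : Fact (pp : ℕ).Prime := ⟨pp.2⟩
      ∀ z ∈ (presAt X hlog pp).latticeF (labelSucc i) 1, ∀ s, ‖z s‖ ≤ R pp i) :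
    (settingPrVolSharp X hlog M archPk archSub Ψ act Mmod region n lat sig split qData tq t htq0 htq1).negLogTheta ≤
      ((processionNormalized (fun i : Fin (thetaIndex X).lstar => ∑ pp ∈ U,
          (haveI : Fact (pp : ℕ).Prime := ⟨pp.2⟩;
            ∑ e : (presAt X hlog pp).toLocalPieces.E (Setting.labelSucc i),
              weightPr X pp.1 (Setting.labelSucc i) e *
                (-(Finset.univ.inf' Finset.univ_nonempty (fun a => m pp i (e a)) * Real.log (pp : ℕ))))) +
        processionNormalized (fun i : Fin (thetaIndex X).lstar =>
          ∑ pp ∈ Bad, max (Real.log (((pp : ℕ) : ℝ) ^ 2 * R pp i / r pp i)) 0) : ℝ) : WithTop ℝ) := by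
  set P := settingPrVolSharp X hlog M archPk archSub Ψ act Mmod region n lat sig split qData tq t htq0 htq1 with hP
  have hfinΘ : P.ThetaFinite :=
    thetaFinite_settingPrVolSharp X hlog M archPk archSub Ψ act Mmod region n lat sig split qData t tq ht0 ht1 htq0 htq1
  have H : BridgeHyps P :=
    bridgeHyps_settingPrVolSharp_of_ideles X hlog M archPk archSub Ψ act Mmod region n lat sig split qData t tq ht0 ht1
      htq0 htq1
  have hunit : ∀ (pp : Nat.Primes), pp ∉ U → ∀ (i : Fin (thetaIndex X).lstar) (x : (thetaIndex X).Fibre (.inr pp)),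
      ‖t pp i x‖ = 1 := fun pp hpp i x => ht1 pp i x fun hS => hpp (hU pp x hS)
  unfold Setting.negLogTheta
  rw [if_pos hfinΘ, WithTop.coe_le_coe]
  have hadd : ∀ f g : Fin (thetaIndex X).lstar → ℝ,
      processionNormalized f + processionNormalized g = processionNormalized (fun i => f i + g i) := fun f g => by
    unfold processionNormalized; rw [Finset.sum_add_distrib, add_div]
  rw [hadd]
  refine processionNormalized_mono fun i => ?_
  -- the pointwise bound: exact on `U`, the crude bound (clipped at `0`) on `Bad`, `0` elsewhere
  let b : (thetaIndex X).VQ → ℝ := fun vQ =>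
    match vQ with
    | .inl _ => 0
    | .inr pp => if pp ∈ U then
        (haveI : Fact (pp : ℕ).Prime := ⟨pp.2⟩;
          ∑ e : (presAt X hlog pp).toLocalPieces.E (Setting.labelSucc i),
            weightPr X pp.1 (Setting.labelSucc i) e *
              (-(Finset.univ.inf' Finset.univ_nonempty (fun a => m pp i (e a)) * Real.log (pp : ℕ))))
      else if pp ∈ Bad then max (Real.log (((pp : ℕ) : ℝ) ^ 2 * R pp i / r pp i)) 0 else 0
  have hb_supp : (Function.support b) ⊆
      (((U ∪ Bad).map ⟨(Sum.inr : Nat.Primes → (thetaIndex X).VQ), fun _ _ h => Sum.inr_injective h⟩ :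
        Finset (thetaIndex X).VQ) : Set (thetaIndex X).VQ) := by
    intro vQ hvQ
    rw [Function.mem_support] at hvQ
    rcases vQ with u | pp
    · exact absurd rfl hvQ
    · rw [Finset.coe_map, Set.mem_image]
      by_cases hpp : pp ∈ U
      · exact ⟨pp, Finset.mem_coe.mpr (Finset.mem_union_left _ hpp), rfl⟩
      · by_cases hpp' : pp ∈ Bad
        · exact ⟨pp, Finset.mem_coe.mpr (Finset.mem_union_right _ hpp'), rfl⟩
        · exact absurd (by show b (.inr pp) = 0; simp only [b, if_neg hpp, if_neg hpp']) hvQ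
  have hb_fin : (Function.support b).Finite := (Finset.finite_toSet _).subset hb_supp
  have hpt : ∀ vQ : (thetaIndex X).VQ, (P.thetaLocal (labelSucc i) vQ).untopD 0 ≤ b vQ := by
    intro vQ
    rcases vQ with u | pp
    · show (P.thetaLocal (labelSucc i) (.inl u)).untopD 0 ≤ 0
      exact (thetaLocal_settingPrVol_untopD_inl X hlog M archPk archSub Ψ act Mmod region n lat sig split qData _ _ _ _
        u i H).le
    · haveI : Fact (pp : ℕ).Prime := ⟨pp.2⟩
      show (P.thetaLocal (labelSucc i) (.inr pp)).untopD 0 ≤ b (.inr pp)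
      by_cases hpp : pp ∈ U
      · rw [show b (.inr pp) = _ from if_pos hpp,
          thetaLocal_untopD_settingPrVolSharp_eq_of_zpow X hlog M archPk archSub Ψ act Mmod region n lat sig split qData t
            tq ht0 htq0 htq1 i pp (hU2 pp hpp) (hUd pp hpp) (m pp i) (hm pp hpp i)]
      · by_cases hpp' : pp ∈ Bad
        · rw [show b (.inr pp) = max (Real.log (((pp : ℕ) : ℝ) ^ 2 * R pp i / r pp i)) 0 by
            simp only [b, if_neg hpp, if_pos hpp']]
          refine le_trans ?_ (le_max_left _ _)
          have h := thetaLocal_settingPrVol_untopD_le_of_polydisc X hlog M archPk archSub Ψ act Mmod region n lat sig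
            split qData _ _ _ _ pp i (hr0 pp i) (hR0 pp i) one_pos (hball pp i) (hbdd pp i)
            (fun _ => thetaBoxDH_sharpBoxDH_subset_of_norm_le X hlog t ht0 pp i fun x => (hunit pp hpp i x).le) H
          rw [mul_one] at h
          exact h
        · rw [show b (.inr pp) = 0 by simp only [b, if_neg hpp, if_neg hpp']]
          have hp2 : 2 < (pp : ℕ) := by
            by_contra h; exact hpp' (hBad2 pp (not_lt.mp h))
          have hdisc : ¬ ((pp : ℕ) : ℤ) ∣ NumberField.discr F := fun h => hpp' (hBadD pp h)
          exact thetaLocal_settingPrVol_untopD_nonpos_of_good X hlog M archPk archSub Ψ act Mmod region n lat sig split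
            qData _ _ _ _ pp hp2 hdisc i
            (fun _ => thetaBoxDH_sharpBoxDH_subset_of_norm_le X hlog t ht0 pp i fun x => (hunit pp hpp i x).le) H
  refine (finsum_le_finsum' (hfinΘ.2 i) hb_fin hpt).trans ?_
  rw [finsum_eq_sum_of_support_subset b hb_supp, Finset.sum_map]
  -- split the sum over `U ∪ Bad` into `U` and `Bad \ U`
  have hsplit : ∑ pp ∈ U ∪ Bad, b (.inr pp) = ∑ pp ∈ U, b (.inr pp) + ∑ pp ∈ Bad \ U, b (.inr pp) := by
    rw [← Finset.sum_union (Finset.disjoint_sdiff), Finset.union_sdiff_self_eq_union]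
  show ∑ pp ∈ U ∪ Bad, b (.inr pp) ≤ _
  rw [hsplit]
  refine add_le_add (le_of_eq (Finset.sum_congr rfl fun pp hpp => ?_)) ?_
  · exact if_pos hpp
  · calc ∑ pp ∈ Bad \ U, b (.inr pp)
        = ∑ pp ∈ Bad \ U, max (Real.log (((pp : ℕ) : ℝ) ^ 2 * R pp i / r pp i)) 0 :=
          Finset.sum_congr rfl fun pp hpp => by
            have h1 : pp ∉ U := (Finset.mem_sdiff.mp hpp).2
            have h2 : pp ∈ Bad := (Finset.mem_sdiff.mp hpp).1
            simp only [b, if_neg h1, if_pos h2]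
      _ ≤ ∑ pp ∈ Bad, max (Real.log (((pp : ℕ) : ℝ) ^ 2 * R pp i / r pp i)) 0 :=
          Finset.sum_le_sum_of_subset_of_nonneg Finset.sdiff_subset fun pp _ _ => le_max_right _ _

end Radii

/-- **THE REGIME DICHOTOMY AT THE VERBATIM SETTING** (module docstring): `∃ C₂ ≥ 0` from `(X, logv)` such that for
every context, every pilot ideles whose bad places lie over a finite set `U` of odd primes unramified in `F`, with
Θ-exponents `m` and `q`-exponents `m_q` over `U`: `(Qside ≤ Θside ⟹ Statement) ∧ (Θside + C₂ < Qside ⟹ ¬ Statement)`.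
No side taken: the positive half is inflation-dominated, the negative half is the `q`-depth; neither is the disputed
inference. [claim: Mochizuki2012, status: disputed] -/
theorem settingPrVolSharp_regime_dichotomy :
    ∃ C₂ : ℝ, 0 ≤ C₂ ∧
      ∀ (M : Type) [Field M] [NumberField M]
        (archPk : ∀ (j : (thetaIndex X).Label) (vQ : (thetaIndex X).VQ), Set ((logShellsDH X logv).Packet j vQ))
        (archSub : ∀ (j : (thetaIndex X).Label) (v : (thetaIndex X).V),
          Set ((logShellsDH X logv).Packet j ((thetaIndex X).over v)))
        (Ψ : ℤ → ∀ v : (thetaIndex X).V, v ∈ (thetaIndex X).Vbad → Set ((logShellsDH X logv).StarPacket v))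
        (act : ℤ → ∀ v : (thetaIndex X).V, v ∈ (thetaIndex X).Vbad →
          (logShellsDH X logv).StarPacket v → Module.End ℚ ((logShellsDH X logv).StarPacket v))
        (Mmod : ℤ → ∀ j : (thetaIndex X).LabelStar, Set ((logShellsDH X logv).GlobalPacket j.1))
        (region : ℤ → ∀ j : (thetaIndex X).LabelStar, FinDivisor M → ∀ vQ : (thetaIndex X).VQ,
          Set ((logShellsDH X logv).Packet j.1 vQ))
        (n : ℤ) (HT : Type) (LogLink : HT → HT → Type) (IsFull : ∀ {s t : HT}, LogLink s t → Prop)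
        (lat : LGPGaussianLogThetaLattice LogLink IsFull)
        (Frd : Type) (IsoF : Frd → Frd → Type) (Ob : Frd → Type) (realify : Frd → Frd) (Strip : Type)
        (IsoS : Strip → Strip → Type) (Mv : ∀ v : (thetaIndex X).V, v ∈ (thetaIndex X).Vbad → Type)
        (_ : ∀ v h, Monoid (Mv v h))
        (sig : GlobalLGPFrobenioidSignature (thetaIndex X).lstar (thetaIndex X).V (· ∈ (thetaIndex X).Vbad)
          Frd IsoF Ob realify Strip IsoS Mv)
        (split : SplittingMonoids Mv) (ObΔ : Type) (N : ∀ v : (thetaIndex X).V, v ∈ (thetaIndex X).Vbad → Type)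
        (_ : ∀ v h, Monoid (N v h)) (qData : QPilotData ObΔ N)
        (tq : ∀ (pp : Nat.Primes) (x : (thetaIndex X).Fibre (.inr pp)),
          haveI : Fact (pp : ℕ).Prime := ⟨pp.2⟩; kOf X pp.1 x)
        (t : ∀ (pp : Nat.Primes) (_ : Fin X.lstar) (x : (thetaIndex X).Fibre (.inr pp)),
          haveI : Fact (pp : ℕ).Prime := ⟨pp.2⟩; kOf X pp.1 x)
        (ht0 : ∀ pp i x, t pp i x ≠ 0)
        (ht1 : ∀ (pp : Nat.Primes) (i : Fin X.lstar) (x : (thetaIndex X).Fibre (.inr pp)),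
          haveI : Fact (pp : ℕ).Prime := ⟨pp.2⟩; placeOf X pp.1 x ∉ X.S → ‖t pp i x‖ = 1)
        (htq0 : ∀ pp x, tq pp x ≠ 0)
        (htq1 : ∀ (pp : Nat.Primes) (x : (thetaIndex X).Fibre (.inr pp)),
          haveI : Fact (pp : ℕ).Prime := ⟨pp.2⟩; placeOf X pp.1 x ∉ X.S → ‖tq pp x‖ = 1)
        (U : Finset Nat.Primes),
        (∀ (pp : Nat.Primes) (x : (thetaIndex X).Fibre (.inr pp)),
          haveI : Fact (pp : ℕ).Prime := ⟨pp.2⟩; placeOf X pp.1 x ∈ X.S → pp ∈ U) →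
        (∀ pp ∈ U, 2 < (pp : ℕ)) → (∀ pp ∈ U, ¬ ((pp : ℕ) : ℤ) ∣ NumberField.discr F) →
        ∀ (m : ∀ pp : Nat.Primes, Fin (thetaIndex X).lstar → (thetaIndex X).Fibre (.inr pp) → ℤ),
        (∀ (pp : Nat.Primes), pp ∈ U → ∀ (i : Fin (thetaIndex X).lstar) (x : (thetaIndex X).Fibre (.inr pp)),
          haveI : Fact (pp : ℕ).Prime := ⟨pp.2⟩; ‖t pp i x‖ = ‖((pp : ℕ) : ℚ_[pp]) ^ m pp i x‖) →
        ∀ (mq : ∀ pp : Nat.Primes, (thetaIndex X).Fibre (.inr pp) → ℤ),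
        (∀ (pp : Nat.Primes), pp ∈ U → ∀ (x : (thetaIndex X).Fibre (.inr pp)),
          haveI : Fact (pp : ℕ).Prime := ⟨pp.2⟩; ‖tq pp x‖ = ‖((pp : ℕ) : ℚ_[pp]) ^ mq pp x‖) →
        ((processionNormalized (fun i : Fin (thetaIndex X).lstar => ∑ pp ∈ U,
            (haveI : Fact (pp : ℕ).Prime := ⟨pp.2⟩;
              ∑ e : (presAt X hlog pp).toLocalPieces.E (Setting.labelSucc i),
                weightPr X pp.1 (Setting.labelSucc i) e * (-(mq pp (e (Fin.last _))) * Real.log (pp : ℕ)))) ≤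
          processionNormalized (fun i : Fin (thetaIndex X).lstar => ∑ pp ∈ U,
            (haveI : Fact (pp : ℕ).Prime := ⟨pp.2⟩;
              ∑ e : (presAt X hlog pp).toLocalPieces.E (Setting.labelSucc i),
                weightPr X pp.1 (Setting.labelSucc i) e *
                  (-(Finset.univ.inf' Finset.univ_nonempty (fun a => m pp i (e a)) * Real.log (pp : ℕ)))))) →
          (settingPrVolSharp X hlog M archPk archSub Ψ act Mmod region n lat sig split qData tq t htq0 htq1).Statement) ∧
        (processionNormalized (fun i : Fin (thetaIndex X).lstar => ∑ pp ∈ U,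
            (haveI : Fact (pp : ℕ).Prime := ⟨pp.2⟩;
              ∑ e : (presAt X hlog pp).toLocalPieces.E (Setting.labelSucc i),
                weightPr X pp.1 (Setting.labelSucc i) e *
                  (-(Finset.univ.inf' Finset.univ_nonempty (fun a => m pp i (e a)) * Real.log (pp : ℕ))))) + C₂ <
          processionNormalized (fun i : Fin (thetaIndex X).lstar => ∑ pp ∈ U,
            (haveI : Fact (pp : ℕ).Prime := ⟨pp.2⟩;
              ∑ e : (presAt X hlog pp).toLocalPieces.E (Setting.labelSucc i),
                weightPr X pp.1 (Setting.labelSucc i) e * (-(mq pp (e (Fin.last _))) * Real.log (pp : ℕ)))) →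
          ¬ (settingPrVolSharp X hlog M archPk archSub Ψ act Mmod region n lat sig split qData tq t htq0 htq1).Statement) := by
  obtain ⟨Bad, r, R, hBad2, hBadD, -, hr0, hR0, hball, hbdd⟩ := exists_bad_and_radii X hlog
  refine ⟨processionNormalized (fun i : Fin (thetaIndex X).lstar =>
    ∑ pp ∈ Bad, max (Real.log (((pp : ℕ) : ℝ) ^ 2 * R pp i / r pp i)) 0), ?_, ?_⟩
  · unfold processionNormalized
    exact div_nonneg (Finset.sum_nonneg fun i _ => Finset.sum_nonneg fun pp _ => le_max_right _ _) (Nat.cast_nonneg _)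
  intro M _ _ archPk archSub Ψ act Mmod region n HT LogLink IsFull lat Frd IsoF Ob realify Strip IsoS Mv _ sig split
    ObΔ N _ qData tq t ht0 ht1 htq0 htq1 U hU hU2 hUd m hm mq hmq
  refine ⟨fun hreg => statement_settingPrVolSharp_of_qside_le_thetaside X hlog M archPk archSub Ψ act Mmod region n lat
    sig split qData t tq ht0 ht1 htq0 htq1 U hU hU2 hUd m hm mq hmq hreg, fun hlt hst => ?_⟩
  have h1 := negLogTheta_settingPrVolSharp_le_exact_of_radii X hlog M archPk archSub Ψ act Mmod region n lat sig split
    qData t tq ht0 ht1 htq0 htq1 U hU hU2 hUd m hm Bad hBad2 hBadD r R hr0 hR0 hball hbdd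
  have h2 := negLogQ_settingPrVolSharp_eq_exact X hlog M archPk archSub Ψ act Mmod region n lat sig split qData t tq htq0
    htq1 U hU mq hmq
  have h3 := WithTop.coe_le_coe.mp (hst.2.trans h1)
  rw [h2] at h3
  linarith

end Real

end Thm311

end IUTFork

end Summit.ABC

end
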